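import Summits.QuantumFields.QCD.Theorems.QuarksNoInfraredClauseThinQCDOfPiecesR5
import Summits.QuantumFields.QCD.Theorems.QuarksNoInfraredClauseThinQCDStubDiagonalExtractionT
import HarnessLib

/-!
# Crux `ThinQCD` (item stmt-QuantumFields-17278) from the pieces of skeleton r6

Support file of line `registered` (route `QuarksNoInfraredClause`, sub-problem QCD; `--supports stmt-QuantumFields-17278`),
the r6 analogue of `…ThinQCDOfPiecesR5.lean` (p168394).  One kernel-checked implication, no `sorry`, no definition:

* `thinQCD_of_pieces_r6` — THE ITEM-LEVEL UPPER BRACKET of the crux after reshape r6 (`Cruxes/ThinQCD/RESHAPE-r6.md`):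
  (S1′ the chiral lattice half) → (U1″ the calibrated lattice package along a chirality-keeping reindexing, r6 currency:
  Goldstone bound, the mass-Lipschitz modulus in TENSOR currency — verbatim the body of `MassLipschitz` of the registered
  stub `stub_calibratedControl` of crux `ChiralCalibratedConvergence`, stmt-18044 — and per tuple biting calibrations / κ₃ /
  (T∧COMP) / CL / CS) → `CounterexampleMustBeHot.RotationRestoration` (8840) → `ThinQCD`.  The diagonal extraction is the
  LANDED DE″ `Summit.QuantumFields.QCD.Theorems.ThinQCD.stub_diagonalExtractionT` (p172524), fed the T-half of (T∧COMP)
  at every positive tuple; the OS closure is the landed `ConvergentOSClosure.stub_closureOfLatticeInputs`; the witness is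
  `reg₁.restrict ψ` with the reindexed calibrated family (term-level, as in r5).

Compared with r5, U1″ drops the locally-uniform ⁰𝒮-tightness altogether and weakens the Lipschitz hypothesis from all
off-diagonal distributions to compactly supported off-diagonal real tensors — so the bracket's middle hypothesis is now
literally downstream of 18044's registered stubs A ∧ V ∧ B1 plus the per-tuple deliverables.

References: Osterwalder–Schrader II (1975) §2, §4; Glimm–Jaffe (1987) §6.1; Montvay–Münster (1994) §5.1.
-/

noncomputable section

namespace Summit.QuantumFields.QCD.Theorems.ThinQCD.R6

open Summit.QuantumFields.QCD.Theorems.ThinQCD.R5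

open scoped BigOperators Topology SchwartzMap
open MeasureTheory Filter
open Literature.MathematicalPhysics.QuantumFieldTheory Literature.MathematicalPhysics.QuantumLattice
  Literature.MathematicalPhysics.AQFT
open Summit.QuantumFields.QCD.Cruxes.StableActionBridge.Sketch (qcdLatticeDist qcdLatticeDistSymAP
  qcdLatticeSchwinger_eq_qcdLatticeDist)
open Summit.QuantumFields.QCD.Theorems.ConvergentOSClosure (stub_closureOfLatticeInputs)
open Summit.QuantumFields.QCD.Cruxes.ThinQCD.Registered (closureOfLatticeInputs_noGap vecCons_one_eq_const)
open Summit.QuantumFields.QCD.Theorems.RobustYangMillsHandover.Negative (hasMassGap_anti)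

variable {Nf : ℕ}

/-! ## The crux from the r6 pieces -/

/-- **`ThinQCD` from S1′, U1″ and `RotationRestoration` — the item-level upper bracket after RESHAPE r6** (lead c3, cycle 4).  U1″ is r5's U1 with the locally-uniform ⁰𝒮-tightness dropped and the mass-Lipschitz modulus asked in TENSOR
currency (verbatim the body of `MassLipschitz` of 18044's registered `stub_calibratedControl`); the diagonal extraction is
the landed DE″ `Summit.QuantumFields.QCD.Theorems.ThinQCD.stub_diagonalExtractionT` (p172524), fed the T-half of the
per-tuple clause (T ∧ COMP) at every positive tuple; everything else as in `thinQCD_of_pieces_r5`. -/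
theorem thinQCD_of_pieces_r6 :
    (∀ Nf : ℕ, Nf = 2 ∨ Nf = 3 → ∃ reg : QCDRegularisation Nf,
          reg.HasMassScaling ∧ reg.IsChiralAtZero ∧ (reg.scheme 0 0 0).HasAsymptoticScaling ∧
            ∀ m : Fin Nf → ℝ, (∀ f, 0 < m f) →
              (∀ f, ∀ᶠ k in Filter.atTop, -1 < (reg.scheme m 0 0).mq f k) ∧
                ∃ Δ > 0, (reg.scheme m 0 0).HasLatticeMassGap Δ) →
    (∀ Nf : ℕ, Nf = 2 ∨ Nf = 3 → ∀ reg : QCDRegularisation Nf, reg.HasMassScaling → reg.IsChiralAtZero →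
          (reg.scheme 0 0 0).HasAsymptoticScaling →
          (∀ m : Fin Nf → ℝ, (∀ f, 0 < m f) →
            (∀ f, ∀ᶠ k in Filter.atTop, -1 < (reg.scheme m 0 0).mq f k) ∧ ∃ Δ > 0, (reg.scheme m 0 0).HasLatticeMassGap Δ) →
          ∃ (φ : ℕ → ℕ) (reg₁ : QCDRegularisation Nf), StrictMono φ ∧ reg₁.a = reg.a ∘ φ ∧ reg₁.β = reg.β ∘ φ ∧
            reg₁.mcrit = reg.mcrit ∘ φ ∧ reg₁.Zm = reg.Zm ∘ φ ∧ (∀ k, reg.L (φ k) ≤ reg₁.L k) ∧ reg₁.HasGoldstoneBound ∧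
            ∃ 𝒞 : CalibratedSpeciesFamily reg₁,
              (∀ n : ℕ, n ≠ 0 → ∀ (σ : Fin n → QCDField Nf) (f : Fin n → SchwartzMap (EuclideanSpace ℝ (Fin 4)) ℝ)
                (F : SchwartzMap (Fin n → EuclideanSpace ℝ (Fin 4)) ℂ), IsTensorOf F (fun i => ofRealTest (f i)) →
                  IsOffDiagonal F → ∀ R : ℝ, (∀ i, tsupport (f i) ⊆ Metric.closedBall 0 R) →
                    ∀ K : Set (Fin Nf → ℝ), IsCompact K → K ⊆ {m | ∀ fl, 0 < m fl} →
                      ∃ C : ℝ, ∀ᶠ k in Filter.atTop, ∀ m ∈ K, ∀ m' ∈ K,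
                        ‖qcdLatticeSchwinger (𝒞.scheme m) k n σ f - qcdLatticeSchwinger (𝒞.scheme m') k n σ f‖ ≤
                          C * ‖m - m'‖) ∧
              ∀ m : Fin Nf → ℝ, (∀ f, 0 < m f) →
                (∀ᶠ k in Filter.atTop,
                  (𝒞.scheme m).twoPoint k QCDField.glue QCDField.glue (thetaTest 4 𝒞.f₀) 𝒞.f₀ = 1) ∧
                (∀ f g : Fin Nf, f ≠ g → ∀ᶠ k in Filter.atTop,
                  (𝒞.scheme m).twoPoint k (QCDField.pseudoRe f g) (QCDField.pseudoRe f g) (thetaTest 4 𝒞.f₀) 𝒞.f₀ = 1) ∧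
                (∃ f g h : SchwartzMap (EuclideanSpace ℝ (Fin 4)) ℝ,
                  tsupport (f : EuclideanSpace ℝ (Fin 4) → ℝ) ⊆ {x | x 0 < 0} ∧
                  tsupport (g : EuclideanSpace ℝ (Fin 4) → ℝ) ⊆ {x | 0 < x 0 ∧ x 0 < 1} ∧
                  tsupport (h : EuclideanSpace ℝ (Fin 4) → ℝ) ⊆ {x | 1 < x 0} ∧
                  ∃ ε > (0 : ℝ), ∀ᶠ k in Filter.atTop, ε ≤ ‖qcdLatticeSchwinger (𝒞.scheme m) k 3
                    ![QCDField.glue, QCDField.glue, QCDField.glue] ![f, g, h] -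
                    qcdLatticeSchwinger (𝒞.scheme m) k 1 ![QCDField.glue] ![f] *
                      qcdLatticeSchwinger (𝒞.scheme m) k 2 ![QCDField.glue, QCDField.glue] ![g, h] -
                    qcdLatticeSchwinger (𝒞.scheme m) k 1 ![QCDField.glue] ![g] *
                      qcdLatticeSchwinger (𝒞.scheme m) k 2 ![QCDField.glue, QCDField.glue] ![f, h] -
                    qcdLatticeSchwinger (𝒞.scheme m) k 1 ![QCDField.glue] ![h] *
                      qcdLatticeSchwinger (𝒞.scheme m) k 2 ![QCDField.glue, QCDField.glue] ![f, g] +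
                    2 * (qcdLatticeSchwinger (𝒞.scheme m) k 1 ![QCDField.glue] ![f] *
                      qcdLatticeSchwinger (𝒞.scheme m) k 1 ![QCDField.glue] ![g] *
                      qcdLatticeSchwinger (𝒞.scheme m) k 1 ![QCDField.glue] ![h])‖) ∧
                (∃ (s : ℕ) (α β : ℝ), 0 ≤ α ∧
                  (∀ (n : ℕ) (σ : Fin n → QCDField Nf), ∀ᶠ k in Filter.atTop,
                    ∀ F : SchwartzMap (Fin n → EuclideanSpace ℝ (Fin 4)) ℂ, IsOffDiagonal F →
                      ‖qcdLatticeDist (𝒞.scheme m) k n σ F‖ ≤ α * (n.factorial : ℝ) ^ β * schwartzNorm (n * s) F) ∧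
                  (∀ ε : ℝ, 0 < ε → ∀ (n : ℕ) (σ : Fin n → QCDField Nf), ∀ᶠ k in Filter.atTop,
                    ∀ F : SchwartzMap (Fin n → EuclideanSpace ℝ (Fin 4)) ℂ, IsOffDiagonal F →
                      ‖qcdLatticeDistSymAP (𝒞.scheme m) k n σ F - qcdLatticeDist (𝒞.scheme m) k n σ F‖ ≤
                        ε * schwartzNorm (n * s) F)) ∧
                (∀ (n n' : ℕ) (σ : Fin n → QCDField Nf) (σ' : Fin n' → QCDField Nf)
                  (F : SchwartzMap (Fin n → EuclideanSpace ℝ (Fin 4)) ℂ) (G : SchwartzMap (Fin n' → EuclideanSpace ℝ (Fin 4)) ℂ),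
                  IsTimeOrdered F → IsTimeOrdered G → ∀ a : EuclideanSpace ℝ (Fin 4), a 0 = 0 → a ≠ 0 →
                  ∀ ε : ℝ, 0 < ε → ∃ t₀ : ℝ, ∀ t : ℝ, t₀ ≤ t →
                    ∀ H : SchwartzMap (Fin (n + n') → EuclideanSpace ℝ (Fin 4)) ℂ,
                      IsAppendTensorOf H (osAdjoint F) (translateMulti (t • a) G) →
                      ∀ᶠ k in Filter.atTop, ‖qcdLatticeDist (𝒞.scheme m) k (n + n') (Fin.append (σ ∘ Fin.rev) σ') H -
                        qcdLatticeDist (𝒞.scheme m) k n (σ ∘ Fin.rev) (osAdjoint F) *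
                          qcdLatticeDist (𝒞.scheme m) k n' σ' G‖ ≤ ε) ∧
                (∃ Δ' > 0, (𝒞.scheme m).HasSpeciesCSClustering Δ')) →
    Summit.QuantumFields.QCD.Theses.CounterexampleMustBeHot.RotationRestoration →
    Summit.QuantumFields.QCD.Theses.QuarksNoInfraredClause.ThinQCD := by
  intro hA hU hR Nf hNf
  have hNf16 : Nf ≤ 16 := le_sixteen_of_two_or_three hNf
  -- S1′: the chiral lattice half
  obtain ⟨reg, hms, hchi, has, hgap⟩ := hA Nf hNf
  -- U1″: the calibrated lattice package along `φ`
  obtain ⟨φ, reg₁, hφ, ha, hβ, hmc, hZm, hL, hG, 𝒞, hLipT, hper⟩ := hU Nf hNf reg hms hchi has hgap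
  -- DE″: the diagonal extraction `ψ` (per-tuple tightness = the T-half of the per-tuple clause (T ∧ COMP))
  obtain ⟨ψ, hψ, hconvψ⟩ := Summit.QuantumFields.QCD.Theorems.ThinQCD.stub_diagonalExtractionT Nf reg₁ 𝒞
    (fun m hm => by
      obtain ⟨-, -, -, ⟨s, α, β, -, hb, -⟩, -⟩ := hper m hm
      exact ⟨s, α, β, hb⟩) hLipT
  have hψt : Tendsto ψ atTop atTop := hψ.tendsto_atTop
  -- the reindexed calibrated family over `reg₁.restrict ψ` (term-level bookkeeping: renormalisations `z_s(m, ψ k)`,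
  -- `shift_s(m, ψ k)`, same reference pair; one-point subtraction and calibration inherited definitionally)
  obtain ⟨𝒞₂, hz, hshift, hf₀⟩ : ∃ 𝒞₂ : CalibratedSpeciesFamily (reg₁.restrict ψ hψt),
      (∀ m s k, 𝒞₂.z m s k = 𝒞.z m s (ψ k)) ∧ (∀ m s k, 𝒞₂.shift m s k = 𝒞.shift m s (ψ k)) ∧ 𝒞₂.f₀ = 𝒞.f₀ :=
    ⟨{ τ₀ := 𝒞.τ₀, τ₀_pos := 𝒞.τ₀_pos, f₀ := 𝒞.f₀, f₀_ne_zero := 𝒞.f₀_ne_zero, tsupport_f₀ := 𝒞.tsupport_f₀,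
       z := fun m s k => 𝒞.z m s (ψ k), shift := fun m s k => 𝒞.shift m s (ψ k),
       z_pos := fun m s k => 𝒞.z_pos m s (ψ k),
       onePointSubtracted := fun m s k f => 𝒞.onePointSubtracted m s (ψ k) f,
       calibrated := fun m s k => 𝒞.calibrated m s (ψ k) }, fun _ _ _ => rfl, fun _ _ _ => rfl, rfl⟩
  -- the witness: `reg₁.restrict ψ` with the reindexed family `reindex 𝒞 ψ`, chiral by the Goldstone bound
  refine ⟨reg₁.restrict ψ hψt, hasMassScaling_transport hφ hψt ha hZm hms, (hG.restrict ψ hψt).isChiralAtZero,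
    fun m hm => ?_⟩
  obtain ⟨hbr, Δ, hΔ, hgapm⟩ := hgap m hm
  obtain ⟨h2g, h2q, h3g, ⟨s, α, β, hα, hb, hcomp⟩, hcl, Δ', hΔ', hCS'⟩ := hper m hm
  have has₂ := hasAsymptoticScaling_transport hφ 𝒞₂ ha hβ has m
  have hbr₂ := branch_transport hφ 𝒞₂ ha hmc hZm hbr
  have hgap₂ := gap_transport hφ 𝒞₂ ha hβ hmc hZm hL hgapm
  have h2g₂ := twoPoint_glue_reindex 𝒞 ψ hψt 𝒞₂ hz hshift hf₀ h2g
  have h2q₂ := twoPoint_pseudoRe_reindex 𝒞 ψ hψt 𝒞₂ hz hshift hf₀ h2q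
  have h3g₂ := kappa3_reindex 𝒞 ψ hψt 𝒞₂ hz hshift h3g
  have hb₂ := bound_reindex 𝒞 ψ hψt 𝒞₂ hz hshift hb
  have hcomp₂ := comp_reindex 𝒞 ψ hψt 𝒞₂ hz hshift hcomp
  have hcl₂ := cl_reindex 𝒞 ψ hψt 𝒞₂ hz hshift hcl
  have hCS₂ := hasSpeciesCSClustering_reindex 𝒞 ψ hψt 𝒞₂ hz hshift hCS'
  have hconv₂ := converges_reindex 𝒞 ψ hψt 𝒞₂ hz hshift (hconvψ m hm)
  -- the OS closure of the lattice-side inputs (landed, scheme-generic, `N_f ≤ 16`)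
  obtain ⟨S, h0, h0', hE0', hE1t, hE2, hE3, hE4, htensor, Δ₁, hΔ₁, hGapS, hGapL⟩ :=
    stub_closureOfLatticeInputs Nf (𝒞₂.scheme m) hNf16 has₂ hbr₂ hconv₂ s α β hα hb₂ hcomp₂ hcl₂
      Δ Δ' hΔ hΔ' hgap₂ hCS₂
  -- E1, packaging
  have hE1 := hR Nf (𝒞₂.scheme m) has₂ hbr₂ ⟨Δ₁, hΔ₁, hGapL⟩ S htensor
  let T : OSData (QCDField Nf) 4 := OSData.ofAxioms S ⟨⟨h0, h0', ⟨hE1t, hE1⟩, hE2, hE3, hE4⟩, hE0'⟩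
  -- the crux body at `m`
  refine ⟨𝒞₂.z m, 𝒞₂.shift m, T, ⟨has₂, hbr₂, htensor⟩, ?_, ?_, h3g₂, Δ₁ / 2,
    half_pos hΔ₁, hasMassGap_anti T (show Δ₁ / 2 ≤ Δ₁ by linarith) hGapS,
    hGapL.neutral.mono (show 2 * (Δ₁ / 2) ≤ Δ₁ by linarith)⟩
  · -- 2-point window of `glue`: the glue calibration at the reference pair (value `1`, one-point functions subtracted)
    refine ⟨thetaTest 4 𝒞₂.f₀, 𝒞₂.f₀, fun x hx => ?_, fun x hx => ?_, 1, one_pos,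
      h2g₂.mono fun k hk => ?_⟩
    · have h := (mem_timeSlab.1 (𝒞₂.tsupport_thetaTest_f₀ hx)).2
      show x 0 < 0
      linarith [𝒞₂.τ₀_pos]
    · have h := (mem_timeSlab.1 (𝒞₂.tsupport_f₀ hx)).1
      show 0 < x 0
      linarith [𝒞₂.τ₀_pos]
    · have h1 : qcdLatticeSchwinger ((reg₁.restrict ψ hψt).scheme m (𝒞₂.z m)
          (𝒞₂.shift m)) k 1 ![QCDField.glue] ![thetaTest 4 𝒞₂.f₀] = 0 := by
        rw [vecCons_one_eq_const, vecCons_one_eq_const]; exact 𝒞₂.onePoint_eq_zero m _ k _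
      have h2 : qcdLatticeSchwinger ((reg₁.restrict ψ hψt).scheme m (𝒞₂.z m)
          (𝒞₂.shift m)) k 2 ![QCDField.glue, QCDField.glue]
          ![thetaTest 4 𝒞₂.f₀, 𝒞₂.f₀] = 1 := hk
      rw [h2, h1, zero_mul, sub_zero, norm_one]
  · -- 2-point windows of the flavour-changing `pseudoRe f₁ f₂`: the `pseudoRe` calibration
    intro f₁ f₂ hne
    refine ⟨thetaTest 4 𝒞₂.f₀, 𝒞₂.f₀, fun x hx => ?_, fun x hx => ?_, 1, one_pos,
      (h2q₂ f₁ f₂ hne).mono fun k hk => ?_⟩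
    · have h := (mem_timeSlab.1 (𝒞₂.tsupport_thetaTest_f₀ hx)).2
      show x 0 < 0
      linarith [𝒞₂.τ₀_pos]
    · have h := (mem_timeSlab.1 (𝒞₂.tsupport_f₀ hx)).1
      show 0 < x 0
      linarith [𝒞₂.τ₀_pos]
    · have h1 : qcdLatticeSchwinger ((reg₁.restrict ψ hψt).scheme m (𝒞₂.z m)
          (𝒞₂.shift m)) k 1 ![QCDField.pseudoRe f₁ f₂] ![thetaTest 4 𝒞₂.f₀] = 0 := by
        rw [vecCons_one_eq_const, vecCons_one_eq_const]; exact 𝒞₂.onePoint_eq_zero m _ k _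
      have h2 : qcdLatticeSchwinger ((reg₁.restrict ψ hψt).scheme m (𝒞₂.z m)
          (𝒞₂.shift m)) k 2 ![QCDField.pseudoRe f₁ f₂, QCDField.pseudoRe f₁ f₂]
          ![thetaTest 4 𝒞₂.f₀, 𝒞₂.f₀] = 1 := hk
      rw [h2, h1, zero_mul, sub_zero, norm_one]

end Summit.QuantumFields.QCD.Theorems.ThinQCD.R6

end
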